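import Mathlib.Analysis.SpecialFunctions.Integrals.Basic
import Summits.QuantumFields.BalabanUV.Beta.EriceFlowEnclosureLogMeanEscape

/-!
# Beta / EriceFlowEnclosureLogScaleAverage — THE CONTINUOUS TWIN OF THE ESCAPE: THE LOG-SCALE AVERAGE IN THE COUPLING `(∫_h^c M(s) ds∕s)∕log(c∕h)`
# (uniform in log s, i.e. in log of RG time) IS REGULAR BUT CAN CREATE A DATUM — `M(s) = sin(log s)` is 1-log-Lipschitz and bounded, its log-scale
# average tends to 0 as h → 0⁺, and M has no limit at 0⁺ — WHEREAS THE HARMONIC SCALE AVERAGE `h·∫_h^c M s⁻² ds` (row L127, = the uniform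
# RG-time cutoff average + o(1) by P2 #53j) CANNOT (P2 #53j∕#53k) (pure [folklore] SERVICE for rows L127 ∕ L131–L142; imports P2 #54f for the
# discrete witness and Mathlib's `∫ x⁻¹ = log`).
#   §1 `integral_inv_eq_log` (`∫_h^c ds∕s = log(c∕h)`), **`logScaleAverage_of_tendsto`** (REGULARITY: M continuous on ]0, c], `M → m` at 0⁺ ⟹ log-scale
#      average → m as h → 0⁺: split at t₀, `|∫_h^{t₀}(M − m)∕s| ≤ (ε∕2)·log(t₀∕h)`, the rest is fixed while `log(c∕h) → ∞`);
#   §2 THE WITNESS `M(s) = sin(log s)`: `integral_sin_log_div` (`∫_h^c sin(log s)∕s ds = cos(log h) − cos(log c)`, FTC with P2 #54f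
#      `hasDerivAt_neg_cos_log`), `sin_log_logLip`, **`sin_log_logScaleAverage_tendsto_zero`** (`|avg| ≤ 2∕log(c∕h) → 0`), **`sin_log_not_tendsto`**
#      (no limit at 0⁺: its samples at `1∕(n+1)` are `−sin(log(n+1))`, P2 #54f `witness_not_tendsto`); END **`logScaleAverage_escapes`**.
# (β-flow team, prover 2 = lower ∕ positivity side, unit `b2b-balaban-beta-bflow-p2`, gen 37; module P2 #54j; no Erice sentence occurs)

HONEST FRAMING (page 1 of everything the β sub-cell writes): discharging `BetaPertH` makes Bałaban's UV stability UNCONDITIONAL — a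
real constructive-QFT result; it is NOT the continuum limit and NOT the Clay problem.  HONEST DEPENDENCY (cell reorg 2026-08-19,
verbatim): «continuum YM on T⁴ ⇐ BetaPertH ∧ nine spine estimates (0/9 proved); BetaPertH ⇐ (D1) ∧ (D4) ∧ CAP+tail; G-an2-4 gates
asym, D1 and NE2/3/4.»  THIS MODULE DISCHARGES NOTHING and quotes nothing: [folklore] real analysis (the logarithmic method for functions at 0⁺,
Hardy, Divergent Series §§1.6, 3.8 via s ↦ 1∕s; Móricz 2013 Cor. 1 is the Tauberian theorem on the power scales, in the tree as the named fact
`Literature.Analysis.Asymptotics.Moricz2013_corollary1` — not used here).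

THE POINT.  In the coupling s the uniform RG-time average is the HARMONIC scale average (weight s⁻² ds, row L127 ∕ P2 #53j) and the logarithmic
RG-time average is the LOG-SCALE average (weight s⁻¹ ds).  The first inherits the Tauberian rigidity of (C,1) along the clock; the second does not:
`∫_h^c sin(log s) ds∕s = cos(log h) − cos(log c)` stays bounded while `log(c∕h) → ∞`.

WHAT THIS FILE PROVES (0 sorry, 0 def): §1 `integral_inv_eq_log`, `intervalIntegrable_div_of_continuousOn`, **`logScaleAverage_of_tendsto`**;
§2 `integral_sin_log_div`, `sin_log_logLip`, **`sin_log_logScaleAverage_tendsto_zero`**, **`sin_log_not_tendsto`**, END **`logScaleAverage_escapes`**.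
NOT CLAIMED: the inclusion «Cesàro∕harmonic scale average → m ⟹ log-scale average → m» for functions (integration by parts; the discrete twin is
P2 #54e `logMean_of_cesaro`); the power-scale Tauberian theorem for functions (Móricz Cor. 1, a NAMED FACT in the tree, unproved there); `BetaPertH`;
continuum; Clay.
-/

namespace Summit.QuantumFields.BalabanUV.Beta.EriceFlowEnclosureLogScaleAverage

open Set Filter Topology MeasureTheory intervalIntegral
open Summit.QuantumFields.BalabanUV.Beta.EriceFlowEnclosureLogMeanEscape (hasDerivAt_neg_cos_log witness_not_tendsto)

noncomputable section

variable {M : ℝ → ℝ} {c : ℝ}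

/-! ## §1 The log-scale average is regular -/

/-- `∫_h^c ds∕s = log(c∕h)` for 0 < h, 0 < c (Mathlib). [folklore] -/
theorem integral_inv_eq_log {h : ℝ} (hh : 0 < h) (hc : 0 < c) : ∫ s in h..c, s⁻¹ = Real.log (c / h) :=
  integral_inv_of_pos hh hc

/-- M continuous on ]0, c] ⟹ `s ↦ M s ∕ s` is interval integrable on [h, c] for 0 < h ≤ c. [folklore] -/
theorem intervalIntegrable_div_of_continuousOn (hcont : ContinuousOn M (Ioc 0 c)) {h : ℝ} (hh : 0 < h) (hhc : h ≤ c) :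
    IntervalIntegrable (fun s => M s / s) volume h c := by
  refine ContinuousOn.intervalIntegrable ?_
  rw [uIcc_of_le hhc]
  exact (hcont.mono fun s hs => ⟨hh.trans_le hs.1, hs.2⟩).div (continuousOn_id) fun s hs => (hh.trans_le hs.1).ne'

/-- **REGULARITY OF THE LOG-SCALE AVERAGE**: M continuous on ]0, c] (c > 0) with `M → m` at 0⁺ ⟹ **`(∫_h^c M(s) ds∕s)∕log(c∕h) → m` as h → 0⁺**.
[folklore] (Hardy, Divergent Series Thm 14 ∕ §3.8, continuous form) -/
theorem logScaleAverage_of_tendsto (hc : 0 < c) (hcont : ContinuousOn M (Ioc 0 c)) {m : ℝ} (hM : Tendsto M (𝓝[>] 0) (𝓝 m)) :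
    Tendsto (fun h => (∫ s in h..c, M s / s) / Real.log (c / h)) (𝓝[>] 0) (𝓝 m) := by
  rw [Metric.tendsto_nhds]
  intro ε hε
  -- t₀ ∈ ]0, c] with |M s − m| ≤ ε∕2 on ]0, t₀]
  have hev : ∀ᶠ s in 𝓝[>] (0:ℝ), dist (M s) m < ε / 2 := Metric.tendsto_nhds.mp hM (ε / 2) (by linarith)
  obtain ⟨t₁, ht₁, ht₁'⟩ : ∃ t₁ > 0, ∀ s, 0 < s → s < t₁ → dist (M s) m < ε / 2 := by
    rw [eventually_nhdsWithin_iff, Metric.eventually_nhds_iff] at hev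
    obtain ⟨t₁, ht₁, h⟩ := hev
    exact ⟨t₁, ht₁, fun s hs0 hs1 => h (by rw [Real.dist_eq, sub_zero, abs_of_pos hs0]; exact hs1) hs0⟩
  set t₀ : ℝ := min (t₁ / 2) c with ht₀
  have ht₀0 : 0 < t₀ := lt_min (by linarith) hc
  have ht₀c : t₀ ≤ c := min_le_right _ _
  have ht₀1 : t₀ < t₁ := lt_of_le_of_lt (min_le_left _ _) (by linarith)
  -- the fixed part D := ∫_{t₀}^c (M s − m)∕s
  set D : ℝ := ∫ s in t₀..c, (M s - m) / s with hD
  -- threshold: log(c∕h) ≥ max 1 (4|D|∕ε), i.e. h ≤ c·exp(−L)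
  set L : ℝ := max 1 (4 * |D| / ε) with hL
  have hL1 : 1 ≤ L := le_max_left _ _
  set h₀ : ℝ := min t₀ (c * Real.exp (-L)) with hh₀
  have hh₀0 : 0 < h₀ := lt_min ht₀0 (by positivity)
  filter_upwards [Ioo_mem_nhdsGT hh₀0] with h hh
  obtain ⟨hh0, hhh₀⟩ := hh
  have hht₀ : h < t₀ := lt_of_lt_of_le hhh₀ (min_le_left _ _)
  have hhc : h ≤ c := (hht₀.trans_le ht₀c).le
  have hlog : L ≤ Real.log (c / h) := by
    have h1 : h ≤ c * Real.exp (-L) := hhh₀.le.trans (min_le_right _ _)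
    have h2 : Real.exp L ≤ c / h := by
      rw [le_div_iff₀ hh0]
      calc Real.exp L * h ≤ Real.exp L * (c * Real.exp (-L)) := mul_le_mul_of_nonneg_left h1 (Real.exp_pos L).le
        _ = c := by rw [mul_comm, mul_assoc, ← Real.exp_add, neg_add_cancel, Real.exp_zero, mul_one]
    have := Real.log_le_log (Real.exp_pos L) h2
    rwa [Real.log_exp] at this
  have hlog0 : 0 < Real.log (c / h) := lt_of_lt_of_le one_pos (hL1.trans hlog)
  -- integrability
  have hi1 : IntervalIntegrable (fun s => (M s - m) / s) volume h t₀ :=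
    (intervalIntegrable_div_of_continuousOn (M := fun s => M s - m) (hcont.sub continuousOn_const) hh0 hhc).mono_set
      (by rw [uIcc_of_le hht₀.le, uIcc_of_le hhc]; exact Icc_subset_Icc le_rfl ht₀c)
  have hi2 : IntervalIntegrable (fun s => (M s - m) / s) volume t₀ c :=
    intervalIntegrable_div_of_continuousOn (M := fun s => M s - m) (hcont.sub continuousOn_const) ht₀0 ht₀c
  have hiM : IntervalIntegrable (fun s => M s / s) volume h c := intervalIntegrable_div_of_continuousOn hcont hh0 hhc
  have hiinv : IntervalIntegrable (fun s : ℝ => s⁻¹) volume h c :=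
    intervalIntegral.intervalIntegrable_inv (fun s hs => (hh0.trans_le (by rw [uIcc_of_le hhc] at hs; exact hs.1)).ne')
      continuousOn_id
  -- avg − m = (∫_h^c (M − m)∕s)∕log(c∕h)
  have hkey : (∫ s in h..c, M s / s) / Real.log (c / h) - m = (∫ s in h..c, (M s - m) / s) / Real.log (c / h) := by
    have h1 : ∫ s in h..c, (M s - m) / s = (∫ s in h..c, M s / s) - m * Real.log (c / h) := by
      rw [← integral_inv_eq_log hh0 hc, ← intervalIntegral.integral_const_mul, ← intervalIntegral.integral_sub hiM (hiinv.const_mul m)]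
      refine intervalIntegral.integral_congr fun s _ => ?_
      simp only [div_eq_mul_inv]
      ring
    rw [h1, sub_div, mul_div_cancel_right₀ _ hlog0.ne']
  rw [Real.dist_eq, hkey, ← intervalIntegral.integral_add_adjacent_intervals hi1 hi2]
  -- the near part
  have hnear : |∫ s in h..t₀, (M s - m) / s| ≤ ε / 2 * Real.log (c / h) := by
    have hb : |∫ s in h..t₀, (M s - m) / s| ≤ ∫ s in h..t₀, (ε / 2) * s⁻¹ := by
      have := intervalIntegral.norm_integral_le_of_norm_le (μ := volume) hht₀.le (f := fun s => (M s - m) / s)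
        (g := fun s => (ε / 2) * s⁻¹)
        (ae_of_all _ fun s hs => by
          have hs0 : 0 < s := hh0.trans hs.1
          rw [Real.norm_eq_abs, abs_div, abs_of_pos hs0, div_eq_mul_inv]
          refine mul_le_mul_of_nonneg_right ?_ (inv_nonneg.mpr hs0.le)
          have := ht₁' s hs0 (lt_of_le_of_lt hs.2 ht₀1); rw [Real.dist_eq] at this; exact this.le)
        ((intervalIntegral.intervalIntegrable_inv (fun s hs => (hh0.trans_le (by rw [uIcc_of_le hht₀.le] at hs; exact hs.1)).ne')
          continuousOn_id).const_mul _)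
      rw [Real.norm_eq_abs] at this; exact this
    rw [intervalIntegral.integral_const_mul, integral_inv_of_pos hh0 ht₀0] at hb
    have hlt : Real.log (t₀ / h) ≤ Real.log (c / h) := Real.log_le_log (by positivity) (div_le_div_of_nonneg_right ht₀c hh0.le)
    have : ε / 2 * Real.log (t₀ / h) ≤ ε / 2 * Real.log (c / h) := mul_le_mul_of_nonneg_left hlt (by linarith)
    linarith
  -- the far part is the constant D, and |D| ≤ (ε∕4)·log(c∕h)
  have hfar : |D| ≤ ε / 4 * Real.log (c / h) := by
    have h1 : 4 * |D| / ε ≤ Real.log (c / h) := (le_max_right _ _).trans hlog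
    rw [div_le_iff₀ hε] at h1; linarith
  rw [abs_div, abs_of_pos hlog0, div_lt_iff₀ hlog0]
  have := abs_add_le (∫ s in h..t₀, (M s - m) / s) D
  have hεlog : 0 < ε * Real.log (c / h) := mul_pos hε hlog0
  linarith

/-! ## §2 The witness `M(s) = sin(log s)` -/

/-- `∫_h^c sin(log s)∕s ds = cos(log h) − cos(log c)` for 0 < h ≤ c (FTC with P2 #54f `hasDerivAt_neg_cos_log`). [folklore] -/
theorem integral_sin_log_div {h : ℝ} (hh : 0 < h) (hhc : h ≤ c) :
    ∫ s in h..c, Real.sin (Real.log s) / s = Real.cos (Real.log h) - Real.cos (Real.log c) := by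
  have hderiv : ∀ x ∈ uIcc h c, HasDerivAt (fun x : ℝ => -Real.cos (Real.log x)) (Real.sin (Real.log x) / x) x := by
    intro x hx; rw [uIcc_of_le hhc] at hx
    exact hasDerivAt_neg_cos_log (hh.trans_le hx.1)
  have hint : IntervalIntegrable (fun x : ℝ => Real.sin (Real.log x) / x) volume h c :=
    intervalIntegrable_div_of_continuousOn (M := fun x => Real.sin (Real.log x)) (c := c)
      ((Real.continuous_sin.comp_continuousOn (Real.continuousOn_log.mono fun s hs => hs.1.ne'))) hh hhc
  rw [intervalIntegral.integral_eq_sub_of_hasDerivAt hderiv hint]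
  ring

/-- `sin(log s)` is 1-log-Lipschitz on ]0, ∞[ and bounded by 1. [folklore] -/
theorem sin_log_logLip :
    (∀ t u : ℝ, 0 < t → t ≤ u → u < 1 → |Real.sin (Real.log u) - Real.sin (Real.log t)| ≤ 1 * Real.log (u / t)) ∧
    (∀ t : ℝ, |Real.sin (Real.log t)| ≤ 1) := by
  refine ⟨fun t u ht htu _ => ?_, fun t => Real.abs_sin_le_one _⟩
  have hu : 0 < u := ht.trans_le htu
  have h1 := Real.abs_sin_sub_sin_le (Real.log u) (Real.log t)
  have h2 : Real.log u - Real.log t = Real.log (u / t) := (Real.log_div hu.ne' ht.ne').symm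
  have h3 : 0 ≤ Real.log (u / t) := Real.log_nonneg (by rw [le_div_iff₀ ht]; linarith)
  rw [h2, abs_of_nonneg h3] at h1
  linarith

/-- **THE LOG-SCALE AVERAGE OF `sin(log s)` TENDS TO 0** as h → 0⁺ (for every c > 0): `|∫_h^c sin(log s)∕s| ≤ 2` while `log(c∕h) → ∞`. [folklore] -/
theorem sin_log_logScaleAverage_tendsto_zero (hc : 0 < c) :
    Tendsto (fun h => (∫ s in h..c, Real.sin (Real.log s) / s) / Real.log (c / h)) (𝓝[>] 0) (𝓝 0) := by
  have hlog : Tendsto (fun h : ℝ => Real.log (c / h)) (𝓝[>] 0) atTop := by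
    have h1 : Tendsto (fun h : ℝ => c / h) (𝓝[>] 0) atTop := Tendsto.const_mul_atTop hc tendsto_inv_nhdsGT_zero
      |>.congr fun h => by rw [div_eq_mul_inv]
    exact Real.tendsto_log_atTop.comp h1
  have h2 : Tendsto (fun h : ℝ => (2 : ℝ) / Real.log (c / h)) (𝓝[>] 0) (𝓝 0) := tendsto_const_nhds.div_atTop hlog
  refine squeeze_zero_norm' ?_ h2
  filter_upwards [Ioo_mem_nhdsGT (show (0:ℝ) < min c (c / Real.exp 1) from lt_min hc (by positivity)),
    hlog.eventually_ge_atTop 1] with h hh hL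
  have hh0 : 0 < h := hh.1
  have hhc : h ≤ c := (lt_of_lt_of_le hh.2 (min_le_left _ _)).le
  have hlog0 : 0 < Real.log (c / h) := lt_of_lt_of_le one_pos hL
  rw [Real.norm_eq_abs, abs_div, abs_of_pos hlog0, integral_sin_log_div hh0 hhc]
  refine div_le_div_of_nonneg_right ?_ hlog0.le
  have := Real.abs_cos_le_one (Real.log h); have := Real.abs_cos_le_one (Real.log c)
  have := abs_sub (Real.cos (Real.log h)) (Real.cos (Real.log c)); linarith

/-- **`sin(log s)` HAS NO LIMIT AT 0⁺**: its samples at `s = 1∕(n+1)` are `−sin(log(n+1))`, which do not converge (P2 #54f `witness_not_tendsto`).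
[folklore] -/
theorem sin_log_not_tendsto : ¬ ∃ m : ℝ, Tendsto (fun s : ℝ => Real.sin (Real.log s)) (𝓝[>] 0) (𝓝 m) := by
  rintro ⟨m, hm⟩
  have hseq : Tendsto (fun n : ℕ => (1 : ℝ) / ((n : ℝ) + 1)) atTop (𝓝[>] 0) := by
    refine tendsto_nhdsWithin_iff.mpr ⟨tendsto_one_div_add_atTop_nhds_zero_nat, Eventually.of_forall fun n => ?_⟩
    exact (by positivity : (0 : ℝ) < 1 / ((n : ℝ) + 1))
  have h1 := hm.comp hseq
  have h2 : Tendsto (fun n : ℕ => Real.sin (Real.log ((n : ℝ) + 1))) atTop (𝓝 (-m)) := by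
    have := h1.neg
    refine this.congr fun n => ?_
    simp only [Function.comp_apply]
    rw [one_div, Real.log_inv, Real.sin_neg, neg_neg]
  exact witness_not_tendsto ⟨-m, h2⟩

/-- **THE LOG-SCALE AVERAGE CAN CREATE A DATUM (END).**  There is M (= `sin(log s)`), 1-log-Lipschitz on ]0, ∞[ and bounded by 1 — so along EVERY
two-loop clock its uniform ∕ Abel ∕ power-weighted cutoff averages and its harmonic scale average converge only if M does (P2 #53b, #53j∕#53k,
#54g) — whose LOG-SCALE average `(∫_h^c M ds∕s)∕log(c∕h)` tends to 0 as h → 0⁺ for every c > 0, although M has NO limit at 0⁺. [folklore] -/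
theorem logScaleAverage_escapes : ∃ M : ℝ → ℝ,
    (∀ t u : ℝ, 0 < t → t ≤ u → u < 1 → |M u - M t| ≤ 1 * Real.log (u / t)) ∧ (∀ t : ℝ, |M t| ≤ 1) ∧
    (∀ c : ℝ, 0 < c → Tendsto (fun h => (∫ s in h..c, M s / s) / Real.log (c / h)) (𝓝[>] 0) (𝓝 0)) ∧
    ¬ ∃ m : ℝ, Tendsto M (𝓝[>] 0) (𝓝 m) :=
  ⟨fun s => Real.sin (Real.log s), sin_log_logLip.1, sin_log_logLip.2, fun _ hc => sin_log_logScaleAverage_tendsto_zero hc,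
    sin_log_not_tendsto⟩

end

end Summit.QuantumFields.BalabanUV.Beta.EriceFlowEnclosureLogScaleAverage
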